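import Mathlib.Analysis.SpecialFunctions.Trigonometric.Bounds
import Mathlib.Analysis.Real.Pi.Bounds
import Summits.QuantumFields.YangMills.Theorems.BalabanUVNodesN19JointLawClosedFormAtScheme

/-!
# YM-DAG node N19 (= NE7 proper) — THE CHEAP CLASS IS RIDGE, NOT JUST ADDITIVE: `h(a·x)` with `Σ_i|a_i| ≤ A` costs `48(KA + G)∕(1 + log r⁻¹)`
# under uniform mixed moments — LINEAR in `A ≤ |ι|`, two-sided along the diagonal

Cell `pub-ymgap`, HUMAN RULING D-0062 (Track A) ∕ D-0149 (work-bound push), R141 (C) wider-strategy seat `pub-ymgap-dag-n19-e` (strategy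
s3 = ALTERNATIVE CURRENCY), generation g27, module 3 (lineage module 108).  Route `Summits/QuantumFields/YangMills/Theses/BalabanUVNodes.lean`,
cluster item K3⁸ «SpineGivenEndpointR13SepCoPHV» (stmt-QuantumFields-27366); filed `--supports` that item `--as helper` (it proves no registered
stub).  COUNT-NEUTRAL: [folklore] bookkeeping over Mathlib and the lineage BY NAME — module 63 `…N19UniformMomentPriceTwoSided`
(`law_price_le_of_uniformMoments`, `exists_uniformMoments_close_laws_far`), p568465 `…N19JointLawBernstein` (`integrable_of_continuous_of_cube`),
module 67 `…N19JointLawClosedFormAtScheme` (`jointLaw_pushforward`, §4 only); no Theses import; §§1–3 have no scheme object, §4 is the by-name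
face AT THE SCHEME under the uniform `Target` HYPOTHESIS (conditional, exactly like module 67); NOT a discharge claim.

CONTEXT.  Module 65 (p584370): general ℓ¹-Lipschitz functionals of `d = |ι|` strings cost `(76K d² + 12G d)∕(1 + L)` under uniform mixed-moment
closeness `r` (`L = log r⁻¹`), ADDITIVE ones `48d(K + G)∕(1 + L)`; the sibling module 107 (`…N19JointLawPriceDimensionSharp`) shows `d²` is the
truth for the general class.  WHICH functionals are cheap?  Not only sums of one-string observables: every RIDGE functional `h(Σ_i a_i x_i)` —
a one-variable profile of a linear statistic of the strings — and hence every finite combination of them with controlled `Σ_m(K_m A_m + G_m)`.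
§1 `linForm_pow_eq_sum` · ★ `abs_integral_linForm_pow_sub_le`: `|∫(Σ_i a_i x_i)^n dP − ∫(Σ_i a_i x_i)^n dQ| ≤ (Σ_i|a_i|)^n·r` — expand the power
   over maps `Fin n → ι` (`Finset.prod_univ_sum`); each term is a mixed monomial (`Finset.prod_fiberwise`).
§2 ★★ `law_price_ridge_le_of_uniformMixedMoments`: `P, Q` on `[−1,1]^ι` with all mixed moments `r`-close, `Σ_i|a_i| ≤ A`, `h` continuous,
   `K`-Lipschitz and `G`-bounded on `[−A, A]`: `|∫h(a·x) dP − ∫h(a·x) dQ| ≤ 48(KA + G)∕(1 + L)` — the push-forwards under `x ↦ a·x∕A` are laws on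
   `[−1,1]` with `r`-close moments (§1), priced by module 63 on the profile `s ↦ h(As)`.  LINEAR in `A ≤ d` (the additive bound of module 65 is
   the case `a = e_i`, summed).
§3 ★ `exists_uniformMixedMoments_close_laws_ridge_far`: the DIAGONAL witness — module 63's pair `μ_n, ν_n` pushed forward under
   `s ↦ (s, …, s)`: all mixed moments `2(1∕2)^n`-close, and the `1`-Lipschitz ridge profile `h(τ) = d(1 − cos(2πnτ∕d))∕(2πn)` of `Σ_i x_i`
   (`A = d`, `0 ≤ h ≤ d`) is paid EXACTLY `d∕(πn)`; ★ `jointLaw_price_ridge_two_sided`: `48(KA + G)∕(1 + L)` against `(d∕7)∕(1 + L)` at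
   `K = 1`, `A = G = d` — the ridge class is `Θ(A∕L)`, like the additive class and UNLIKE the general class (`Θ(d²∕(d + L))`, module 107): the
   factor `|ι|` of module 107 is paid for genuinely multivariate (non-ridge) structure only.
§4 ★ `abs_integral_ridge_sub_jointLaw_le_of_uniformTarget`: AT THE SCHEME (module 67's `jointLaw_pushforward` BY NAME): under
   `Spine.NE7.Target vol l₀ δ (schemeZ S os)` for every string, a finite family `os : ι → List O` with continuum joint law `ν`, and a step `K` with
   `R_K ∈ (0,1]`: `|∫ h(Σ_i a_i ∏os_i) dgibbs_K − ∫ h(Σ_i a_i x_i) dν| ≤ 48(K_h A + G_h)∕(1 + log R_K⁻¹)` — ridge statistics of `d` strings converge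
   at the ONE-string rate times `A ≤ d`, not `d²` (module 67's general closed form).

HONEST FRAMING (binding).  Elementary and [folklore]; TOY laws; NO consumer in the DAG today (an optimality statement about the seat's own
currency); nothing of Bałaban's instantiated; NE7 NOT PRINTED, NOT proved; N19 NOT discharged; count-neutral.  One finite `T⁴` programme at fixed
`ε`; nothing continuum ∕ `ℝ⁴` ∕ OS ∕ mass-gap ∕ Clay.  0 `def` ∕ 0 `sorry`.
-/

noncomputable section

open Real Finset MeasureTheory

namespace Summit.QuantumFields.YangMills.Theorems.BalabanUVNodesN19JointLawPriceRidge

open Summit.QuantumFields.YangMills.Theorems.BalabanUVNodesN19UniformMomentPriceTwoSided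
  (law_price_le_of_uniformMoments exists_uniformMoments_close_laws_far)
open Summit.QuantumFields.YangMills.Theorems.BalabanUVNodesN19JointLawBernstein (integrable_of_continuous_of_cube)

variable {ι : Type*} [Fintype ι] [DecidableEq ι]

/-! ## §1 Powers of a linear statistic are combinations of mixed monomials with total weight `(Σ_i|a_i|)^n` [bookkeeping] -/

/-- `∏_k x_{f(k)} = ∏_i x_i^{#f⁻¹(i)}`. [bookkeeping] -/
theorem prod_apply_eq_prod_pow_card {n : ℕ} (f : Fin n → ι) (x : ι → ℝ) :
    ∏ k, x (f k) = ∏ i, x i ^ (Finset.univ.filter fun k => f k = i).card := by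
  rw [← Finset.prod_fiberwise Finset.univ f (fun k => x (f k))]
  refine Finset.prod_congr rfl fun i _ => ?_
  rw [Finset.prod_congr rfl (fun k hk => by rw [(Finset.mem_filter.1 hk).2]), Finset.prod_const]

/-- `(Σ_i a_i x_i)^n = Σ_{f : Fin n → ι} (∏_k a_{f(k)}) · ∏_i x_i^{#f⁻¹(i)}`. [bookkeeping] -/
theorem linForm_pow_eq_sum (a x : ι → ℝ) (n : ℕ) :
    (∑ i, a i * x i) ^ n = ∑ f : Fin n → ι, (∏ k, a (f k)) * ∏ i, x i ^ (Finset.univ.filter fun k => f k = i).card := by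
  have h1 : (∑ i, a i * x i) ^ n = ∏ _k : Fin n, ∑ i, a i * x i := by
    rw [Finset.prod_const, Finset.card_univ, Fintype.card_fin]
  rw [h1, Finset.prod_univ_sum (fun _ : Fin n => (Finset.univ : Finset ι)) (fun _ i => a i * x i), Fintype.piFinset_univ]
  refine Finset.sum_congr rfl fun f _ => ?_
  rw [Finset.prod_mul_distrib, prod_apply_eq_prod_pow_card f x]

omit [DecidableEq ι] in
/-- `Σ_{f : Fin n → ι} ∏_k |a_{f(k)}| = (Σ_i |a_i|)^n`. [bookkeeping] -/
theorem sum_prod_abs_eq_pow (a : ι → ℝ) (n : ℕ) : ∑ f : Fin n → ι, ∏ k, |a (f k)| = (∑ i, |a i|) ^ n := by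
  have h1 : (∑ i, |a i|) ^ n = ∏ _k : Fin n, ∑ i, |a i| := by
    rw [Finset.prod_const, Finset.card_univ, Fintype.card_fin]
  rw [h1, Finset.prod_univ_sum (fun _ : Fin n => (Finset.univ : Finset ι)) (fun _ i => |a i|), Fintype.piFinset_univ]

/-- ★ Under `r`-closeness of ALL mixed moments, the `n`-th moments of a linear statistic are `(Σ_i|a_i|)^n·r`-close. [folklore] -/
theorem abs_integral_linForm_pow_sub_le {P Q : Measure (ι → ℝ)} [IsProbabilityMeasure P] [IsProbabilityMeasure Q]
    (hP : P (Set.pi Set.univ (fun _ : ι => Set.Icc (-1 : ℝ) 1))ᶜ = 0) (hQ : Q (Set.pi Set.univ (fun _ : ι => Set.Icc (-1 : ℝ) 1))ᶜ = 0)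
    {r : ℝ} (hmom : ∀ j : ι → ℕ, |∫ x, ∏ i, x i ^ j i ∂P - ∫ x, ∏ i, x i ^ j i ∂Q| ≤ r) (a : ι → ℝ) (n : ℕ) :
    |∫ x, (∑ i, a i * x i) ^ n ∂P - ∫ x, (∑ i, a i * x i) ^ n ∂Q| ≤ (∑ i, |a i|) ^ n * r := by
  have hcont : ∀ f : Fin n → ι, Continuous fun x : ι → ℝ => ∏ i, x i ^ (Finset.univ.filter fun k => f k = i).card := fun f =>
    continuous_finsetProd _ fun i _ => (continuous_apply i).pow _
  have hexp : ∀ (μ : Measure (ι → ℝ)) [IsProbabilityMeasure μ], μ (Set.pi Set.univ (fun _ : ι => Set.Icc (-1 : ℝ) 1))ᶜ = 0 →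
      ∫ x, (∑ i, a i * x i) ^ n ∂μ =
        ∑ f : Fin n → ι, (∏ k, a (f k)) * ∫ x, ∏ i, x i ^ (Finset.univ.filter fun k => f k = i).card ∂μ := by
    intro μ _ hμ
    have hfun : (fun x : ι → ℝ => (∑ i, a i * x i) ^ n) =
        fun x => ∑ f : Fin n → ι, (∏ k, a (f k)) * ∏ i, x i ^ (Finset.univ.filter fun k => f k = i).card := by
      funext x; exact linForm_pow_eq_sum a x n
    rw [hfun, integral_finsetSum _ (fun f _ => (integrable_of_continuous_of_cube hμ (hcont f)).const_mul _)]
    refine Finset.sum_congr rfl fun f _ => ?_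
    rw [integral_const_mul]
  rw [hexp P hP, hexp Q hQ, ← Finset.sum_sub_distrib]
  calc |∑ f : Fin n → ι, ((∏ k, a (f k)) * ∫ x, ∏ i, x i ^ (Finset.univ.filter fun k => f k = i).card ∂P -
          (∏ k, a (f k)) * ∫ x, ∏ i, x i ^ (Finset.univ.filter fun k => f k = i).card ∂Q)|
      ≤ ∑ f : Fin n → ι, |(∏ k, a (f k)) * ∫ x, ∏ i, x i ^ (Finset.univ.filter fun k => f k = i).card ∂P -
          (∏ k, a (f k)) * ∫ x, ∏ i, x i ^ (Finset.univ.filter fun k => f k = i).card ∂Q| := abs_sum_le_sum_abs _ _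
    _ ≤ ∑ f : Fin n → ι, (∏ k, |a (f k)|) * r := Finset.sum_le_sum fun f _ => by
        rw [← mul_sub, abs_mul, Finset.abs_prod]
        exact mul_le_mul_of_nonneg_left (hmom _) (Finset.prod_nonneg fun k _ => abs_nonneg _)
    _ = (∑ i, |a i|) ^ n * r := by rw [← Finset.sum_mul, sum_prod_abs_eq_pow]

/-! ## §2 ★★ Ridge functionals are priced LINEARLY in `A = Σ_i|a_i|` [folklore] -/

omit [DecidableEq ι] in
/-- On the cube, `|Σ_i a_i x_i| ≤ Σ_i |a_i|`. [bookkeeping] -/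
theorem abs_linForm_le {a x : ι → ℝ} (hx : ∀ i, x i ∈ Set.Icc (-1 : ℝ) 1) : |∑ i, a i * x i| ≤ ∑ i, |a i| := by
  refine (abs_sum_le_sum_abs _ _).trans (Finset.sum_le_sum fun i _ => ?_)
  rw [abs_mul]
  exact mul_le_of_le_one_right (abs_nonneg _) (abs_le.2 ⟨(hx i).1, (hx i).2⟩)

omit [DecidableEq ι] in
/-- The push-forward of a law on the cube under the normalised linear statistic `x ↦ (Σ_i a_i x_i)∕A` (`Σ_i|a_i| ≤ A`, `A > 0`) is carried by
`[−1,1]`. [bookkeeping] -/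
theorem map_linForm_Icc_compl {P : Measure (ι → ℝ)} (hP : P (Set.pi Set.univ (fun _ : ι => Set.Icc (-1 : ℝ) 1))ᶜ = 0)
    (a : ι → ℝ) {A : ℝ} (hA0 : 0 < A) (hA : ∑ i, |a i| ≤ A) :
    (P.map fun x : ι → ℝ => (∑ i, a i * x i) / A) (Set.Icc (-1 : ℝ) 1)ᶜ = 0 := by
  have hu : Continuous fun x : ι → ℝ => (∑ i, a i * x i) / A :=
    (continuous_finsetSum _ fun i _ => continuous_const.mul (continuous_apply i)).div_const _
  rw [Measure.map_apply hu.measurable measurableSet_Icc.compl]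
  refine measure_mono_null (fun x hx => ?_) hP
  intro hxc
  apply hx
  have hb := abs_linForm_le (a := a) (fun i => Set.mem_univ_pi.1 hxc i)
  show (∑ i, a i * x i) / A ∈ Set.Icc (-1 : ℝ) 1
  rw [Set.mem_Icc, ← abs_le, abs_div, abs_of_pos hA0, div_le_one hA0]
  exact hb.trans hA

omit [DecidableEq ι] in
/-- Integration against the push-forward under the normalised linear statistic. [bookkeeping] -/
theorem integral_map_linForm (P : Measure (ι → ℝ)) (a : ι → ℝ) (A : ℝ) {g : ℝ → ℝ} (hg : Continuous g) :
    ∫ s, g s ∂(P.map fun x : ι → ℝ => (∑ i, a i * x i) / A) = ∫ x, g ((∑ i, a i * x i) / A) ∂P := by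
  have hu : Continuous fun x : ι → ℝ => (∑ i, a i * x i) / A :=
    (continuous_finsetSum _ fun i _ => continuous_const.mul (continuous_apply i)).div_const _
  exact integral_map hu.measurable.aemeasurable hg.aestronglyMeasurable

/-- ★★ **RIDGE FUNCTIONALS: `48(KA + G)∕(1 + log r⁻¹)`.**  `P, Q` on `[−1,1]^ι` with all mixed moments `r`-close (`0 < r ≤ 1`); `a : ι → ℝ`
with `Σ_i|a_i| ≤ A` (`A > 0`); `h` continuous, `K`-Lipschitz and `G`-bounded on `[−A, A]`.  Then
`|∫h(Σ_i a_i x_i) dP − ∫h(Σ_i a_i x_i) dQ| ≤ 48(KA + G)∕(1 + log r⁻¹)` — LINEAR in `A ≤ |ι|`: the push-forwards under `x ↦ a·x∕A` have `r`-close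
moments (§1) and module 63 prices the profile `s ↦ h(As)`. [folklore] -/
theorem law_price_ridge_le_of_uniformMixedMoments {P Q : Measure (ι → ℝ)} [IsProbabilityMeasure P] [IsProbabilityMeasure Q]
    (hP : P (Set.pi Set.univ (fun _ : ι => Set.Icc (-1 : ℝ) 1))ᶜ = 0) (hQ : Q (Set.pi Set.univ (fun _ : ι => Set.Icc (-1 : ℝ) 1))ᶜ = 0)
    {r : ℝ} (hr0 : 0 < r) (hr1 : r ≤ 1)
    (hmom : ∀ j : ι → ℕ, |∫ x, ∏ i, x i ^ j i ∂P - ∫ x, ∏ i, x i ^ j i ∂Q| ≤ r)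
    (a : ι → ℝ) {A : ℝ} (hA0 : 0 < A) (hA : ∑ i, |a i| ≤ A) {h : ℝ → ℝ} (hh : Continuous h) {K G : ℝ} (hK0 : 0 ≤ K)
    (hK : ∀ s s' : ℝ, s ∈ Set.Icc (-A) A → s' ∈ Set.Icc (-A) A → |h s - h s'| ≤ K * |s - s'|)
    (hG : ∀ s : ℝ, s ∈ Set.Icc (-A) A → |h s| ≤ G) :
    |∫ x, h (∑ i, a i * x i) ∂P - ∫ x, h (∑ i, a i * x i) ∂Q| ≤ 48 * (K * A + G) / (1 + Real.log r⁻¹) := by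
  set u : (ι → ℝ) → ℝ := fun x => (∑ i, a i * x i) / A with hu
  have huc : Continuous u := (continuous_finsetSum _ fun i _ => continuous_const.mul (continuous_apply i)).div_const _
  haveI : IsProbabilityMeasure (P.map u) := Measure.isProbabilityMeasure_map huc.measurable.aemeasurable
  haveI : IsProbabilityMeasure (Q.map u) := Measure.isProbabilityMeasure_map huc.measurable.aemeasurable
  -- the profile `g(s) = h(As)` on `[−1,1]`
  set g : ℝ → ℝ := fun s => h (A * s) with hg
  have hgc : Continuous g := hh.comp (continuous_const.mul continuous_id)
  have hAs : ∀ s : ℝ, s ∈ Set.Icc (-1 : ℝ) 1 → A * s ∈ Set.Icc (-A) A := fun s hs =>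
    ⟨by nlinarith [hs.1], by nlinarith [hs.2]⟩
  have hgK : ∀ s s' : ℝ, s ∈ Set.Icc (-1 : ℝ) 1 → s' ∈ Set.Icc (-1 : ℝ) 1 → |g s - g s'| ≤ K * A * |s - s'| := by
    intro s s' hs hs'
    calc |g s - g s'| = |h (A * s) - h (A * s')| := rfl
      _ ≤ K * |A * s - A * s'| := hK _ _ (hAs s hs) (hAs s' hs')
      _ = K * A * |s - s'| := by rw [← mul_sub, abs_mul, abs_of_pos hA0, mul_assoc]
  have hgG : ∀ s : ℝ, s ∈ Set.Icc (-1 : ℝ) 1 → |g s| ≤ G := fun s hs => hG _ (hAs s hs)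
  -- the moments of the push-forwards
  have hmomu : ∀ n : ℕ, |∫ s, s ^ n ∂(P.map u) - ∫ s, s ^ n ∂(Q.map u)| ≤ r := by
    intro n
    rw [integral_map_linForm P a A (continuous_pow n), integral_map_linForm Q a A (continuous_pow n)]
    have hdiv : ∀ μ : Measure (ι → ℝ), ∫ x, ((∑ i, a i * x i) / A) ^ n ∂μ = (∫ x, (∑ i, a i * x i) ^ n ∂μ) / A ^ n := by
      intro μ; simp_rw [div_pow]; rw [integral_div]
    rw [hdiv P, hdiv Q, ← sub_div, abs_div, abs_of_pos (pow_pos hA0 n), div_le_iff₀ (pow_pos hA0 n)]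
    calc |∫ x, (∑ i, a i * x i) ^ n ∂P - ∫ x, (∑ i, a i * x i) ^ n ∂Q| ≤ (∑ i, |a i|) ^ n * r :=
          abs_integral_linForm_pow_sub_le hP hQ hmom a n
      _ ≤ A ^ n * r := mul_le_mul_of_nonneg_right
          (pow_le_pow_left₀ (Finset.sum_nonneg fun i _ => abs_nonneg _) hA n) hr0.le
      _ = r * A ^ n := mul_comm _ _
  have hprice := law_price_le_of_uniformMoments (μ := Q.map u) (ν := P.map u)
    (map_linForm_Icc_compl hQ a hA0 hA) (map_linForm_Icc_compl hP a hA0 hA) hr0 hr1 hmomu hgc (mul_nonneg hK0 hA0.le) hgK hgG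
  have hback : ∀ μ : Measure (ι → ℝ), ∫ s, g s ∂(μ.map u) = ∫ x, h (∑ i, a i * x i) ∂μ := by
    intro μ
    rw [integral_map_linForm μ a A hgc]
    refine integral_congr_ae (Filter.Eventually.of_forall fun x => ?_)
    simp only [hg, mul_div_cancel₀ _ hA0.ne']
  rwa [hback P, hback Q] at hprice

/-! ## §3 The diagonal witness: the ridge class is `Θ(A∕log r⁻¹)` two-sided [folklore] -/

omit [DecidableEq ι] in
/-- The ridge profile `h(τ) = d(1 − cos(2πnτ∕d))∕(2πn)` is `1`-Lipschitz. [bookkeeping] -/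
theorem abs_ridgeProfile_sub_le {d : ℝ} (hd : 0 < d) {n : ℕ} (hn : 0 < n) (τ τ' : ℝ) :
    |d * ((1 - Real.cos (π * (2 * n : ℕ) * (τ / d))) / (π * (2 * n : ℕ))) -
        d * ((1 - Real.cos (π * (2 * n : ℕ) * (τ' / d))) / (π * (2 * n : ℕ)))| ≤ |τ - τ'| := by
  have hn' : (0 : ℝ) < (2 * n : ℕ) := by exact_mod_cast (by omega : 0 < 2 * n)
  have hc : 0 < π * (2 * n : ℕ) := mul_pos Real.pi_pos hn'
  have hcos := Real.abs_cos_sub_cos_le (π * (2 * n : ℕ) * (τ' / d)) (π * (2 * n : ℕ) * (τ / d))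
  have heq : d * ((1 - Real.cos (π * (2 * n : ℕ) * (τ / d))) / (π * (2 * n : ℕ))) -
      d * ((1 - Real.cos (π * (2 * n : ℕ) * (τ' / d))) / (π * (2 * n : ℕ))) =
      (d / (π * (2 * n : ℕ))) * (Real.cos (π * (2 * n : ℕ) * (τ' / d)) - Real.cos (π * (2 * n : ℕ) * (τ / d))) := by
    field_simp; ring
  rw [heq, abs_mul, abs_of_pos (div_pos hd hc)]
  calc d / (π * (2 * n : ℕ)) * |Real.cos (π * (2 * n : ℕ) * (τ' / d)) - Real.cos (π * (2 * n : ℕ) * (τ / d))|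
      ≤ d / (π * (2 * n : ℕ)) * |π * (2 * n : ℕ) * (τ' / d) - π * (2 * n : ℕ) * (τ / d)| :=
        mul_le_mul_of_nonneg_left hcos (div_pos hd hc).le
    _ = |τ - τ'| := by
        rw [← mul_sub, abs_mul, abs_of_pos hc, ← sub_div, abs_div, abs_of_pos hd, abs_sub_comm]
        field_simp

omit [DecidableEq ι] in
/-- The ridge profile takes values in `[0, d∕(πn)]`. [bookkeeping] -/
theorem ridgeProfile_mem {d : ℝ} (hd : 0 < d) {n : ℕ} (hn : 0 < n) (τ : ℝ) :
    0 ≤ d * ((1 - Real.cos (π * (2 * n : ℕ) * (τ / d))) / (π * (2 * n : ℕ))) ∧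
      d * ((1 - Real.cos (π * (2 * n : ℕ) * (τ / d))) / (π * (2 * n : ℕ))) ≤ d / (π * n) := by
  have hn' : (0 : ℝ) < n := by exact_mod_cast hn
  have hc : 0 < π * (2 * n : ℕ) := by positivity
  have h1 := Real.cos_le_one (π * (2 * n : ℕ) * (τ / d))
  have h2 := Real.neg_one_le_cos (π * (2 * n : ℕ) * (τ / d))
  refine ⟨mul_nonneg hd.le (div_nonneg (by linarith) hc.le), ?_⟩
  rw [mul_div_assoc']
  rw [div_le_div_iff₀ hc (by positivity)]
  push_cast at h1 h2 ⊢
  have hX : 0 ≤ d * π * n := by positivity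
  nlinarith [mul_nonneg hX (by linarith : (0 : ℝ) ≤ 1 + Real.cos (π * (2 * n) * (τ / d)))]

/-- ★ THE DIAGONAL WITNESS.  For every `n ≥ 1` there are probability laws `P, Q` on `[−1,1]^ι` (indeed on the diagonal of `[0,1]^ι`) with ALL
mixed moments `2(1∕2)^n`-close and the `1`-Lipschitz ridge profile `h(τ) = d(1 − cos(2πnτ∕d))∕(2πn)` of the statistic `Σ_i x_i`
(`Σ_i|a_i| = d`, `0 ≤ h ≤ d∕(πn)`) paid EXACTLY `d∕(πn)` — module 63's pair pushed forward under `s ↦ (s, …, s)`. [folklore] -/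
theorem exists_uniformMixedMoments_close_laws_ridge_far (ι : Type*) [Fintype ι] [Nonempty ι] {n : ℕ} (hn : 0 < n) :
    ∃ P Q : Measure (ι → ℝ), IsProbabilityMeasure P ∧ IsProbabilityMeasure Q ∧
      P (Set.pi Set.univ (fun _ : ι => Set.Icc (-1 : ℝ) 1))ᶜ = 0 ∧ Q (Set.pi Set.univ (fun _ : ι => Set.Icc (-1 : ℝ) 1))ᶜ = 0 ∧
      (∀ j : ι → ℕ, |∫ x, ∏ i, x i ^ j i ∂P - ∫ x, ∏ i, x i ^ j i ∂Q| ≤ 2 * (1 / 2 : ℝ) ^ n) ∧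
      |∫ x, (Fintype.card ι : ℝ) * ((1 - Real.cos (π * (2 * n : ℕ) * ((∑ i, x i) / Fintype.card ι))) / (π * (2 * n : ℕ))) ∂P -
        ∫ x, (Fintype.card ι : ℝ) * ((1 - Real.cos (π * (2 * n : ℕ) * ((∑ i, x i) / Fintype.card ι))) / (π * (2 * n : ℕ))) ∂Q| =
        Fintype.card ι / (π * n) := by
  obtain ⟨μ, ν, hμ, hν, hμc, hνc, hmom, -, hpay⟩ := exists_uniformMoments_close_laws_far hn
  set d : ℕ := Fintype.card ι with hd
  have hd1 : (0 : ℝ) < d := by exact_mod_cast (Fintype.card_pos : 0 < d)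
  set diag : ℝ → (ι → ℝ) := fun s _ => s with hdiag
  have hdc : Continuous diag := continuous_pi fun _ => continuous_id
  haveI : IsProbabilityMeasure (ν.map diag) := Measure.isProbabilityMeasure_map hdc.measurable.aemeasurable
  haveI : IsProbabilityMeasure (μ.map diag) := Measure.isProbabilityMeasure_map hdc.measurable.aemeasurable
  -- carried by the cube
  have hcarry : ∀ (κ : Measure ℝ), κ (Set.Icc 0 1)ᶜ = 0 → (κ.map diag) (Set.pi Set.univ (fun _ : ι => Set.Icc (-1 : ℝ) 1))ᶜ = 0 := by
    intro κ hκ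
    rw [Measure.map_apply hdc.measurable (MeasurableSet.univ_pi fun _ => measurableSet_Icc).compl]
    refine measure_mono_null (fun s hs => ?_) hκ
    intro hs01
    apply hs
    exact Set.mem_univ_pi.2 fun _ => ⟨by linarith [hs01.1], hs01.2⟩
  -- integration against the push-forward
  have hint : ∀ (κ : Measure ℝ) {F : (ι → ℝ) → ℝ}, Continuous F → ∫ x, F x ∂(κ.map diag) = ∫ s, F (diag s) ∂κ :=
    fun κ F hF => integral_map hdc.measurable.aemeasurable hF.aestronglyMeasurable
  -- mixed moments
  have hmomι : ∀ j : ι → ℕ, |∫ x, ∏ i, x i ^ j i ∂(ν.map diag) - ∫ x, ∏ i, x i ^ j i ∂(μ.map diag)| ≤ 2 * (1 / 2 : ℝ) ^ n := by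
    intro j
    have hc : Continuous fun x : ι → ℝ => ∏ i, x i ^ j i := continuous_finsetProd _ fun i _ => (continuous_apply i).pow _
    rw [hint ν hc, hint μ hc]
    simp only [hdiag, Finset.prod_pow_eq_pow_sum]
    exact hmom _
  -- the ridge test on the diagonal
  have hsum : ∀ s : ℝ, (∑ _i : ι, s) / (d : ℝ) = s := fun s => by
    rw [Finset.sum_const, Finset.card_univ, nsmul_eq_mul, ← hd]; field_simp
  have htc : Continuous fun x : ι → ℝ =>
      (d : ℝ) * ((1 - Real.cos (π * (2 * n : ℕ) * ((∑ i, x i) / d))) / (π * (2 * n : ℕ))) := by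
    refine continuous_const.mul (Continuous.div_const (continuous_const.sub (Real.continuous_cos.comp ?_)) _)
    exact continuous_const.mul ((continuous_finsetSum _ fun i _ => continuous_apply i).div_const _)
  have htest : ∀ (κ : Measure ℝ), ∫ x, (d : ℝ) * ((1 - Real.cos (π * (2 * n : ℕ) * ((∑ i, x i) / d))) / (π * (2 * n : ℕ))) ∂(κ.map diag) =
      (d : ℝ) * ∫ s, (1 - Real.cos (π * (2 * n : ℕ) * s)) / (π * (2 * n : ℕ)) ∂κ := by
    intro κ
    rw [hint κ htc, ← integral_const_mul]
    refine integral_congr_ae (Filter.Eventually.of_forall fun s => ?_)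
    simp only [hdiag, hsum]
  refine ⟨ν.map diag, μ.map diag, inferInstance, inferInstance, hcarry ν hνc, hcarry μ hμc, hmomι, ?_⟩
  rw [htest ν, htest μ, ← mul_sub, abs_mul, abs_of_pos hd1, hpay, mul_one_div]

/-- ★ **THE RIDGE CLASS, TWO-SIDED** (`d = |ι|`, `L = log r⁻¹`): (1) every ridge functional `h(Σ_i a_i x_i)` (`Σ|a_i| ≤ A`, `h` `K`-Lipschitz and
`G`-bounded on `[−A,A]`) is paid at most `48(KA + G)∕(1 + L)` under `r`-closeness of all mixed moments; (2) for every `0 < r₀ ≤ 1` there are laws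
with all mixed moments `r`-close for some `0 < r ≤ r₀` and a `1`-Lipschitz ridge profile of `Σ_i x_i` (`A = d`, values in `[0, d]`) paid at
least `(d∕7)∕(1 + L)`.  So the ridge class is `Θ(A∕L)` — like the additive class (module 66) and unlike the general class (`Θ(d²∕(d + L))`,
module 107). [folklore] -/
theorem jointLaw_price_ridge_two_sided (ι : Type*) [Fintype ι] [DecidableEq ι] [Nonempty ι] :
    (∀ (P Q : Measure (ι → ℝ)) [IsProbabilityMeasure P] [IsProbabilityMeasure Q],
      P (Set.pi Set.univ (fun _ : ι => Set.Icc (-1 : ℝ) 1))ᶜ = 0 → Q (Set.pi Set.univ (fun _ : ι => Set.Icc (-1 : ℝ) 1))ᶜ = 0 →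
      ∀ r : ℝ, 0 < r → r ≤ 1 → (∀ j : ι → ℕ, |∫ x, ∏ i, x i ^ j i ∂P - ∫ x, ∏ i, x i ^ j i ∂Q| ≤ r) →
      ∀ (a : ι → ℝ) (A : ℝ), 0 < A → ∑ i, |a i| ≤ A → ∀ h : ℝ → ℝ, Continuous h → ∀ K G : ℝ, 0 ≤ K →
        (∀ s s' : ℝ, s ∈ Set.Icc (-A) A → s' ∈ Set.Icc (-A) A → |h s - h s'| ≤ K * |s - s'|) →
        (∀ s : ℝ, s ∈ Set.Icc (-A) A → |h s| ≤ G) →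
        |∫ x, h (∑ i, a i * x i) ∂P - ∫ x, h (∑ i, a i * x i) ∂Q| ≤ 48 * (K * A + G) / (1 + Real.log r⁻¹)) ∧
    (∀ r₀ : ℝ, 0 < r₀ → r₀ ≤ 1 → ∃ P Q : Measure (ι → ℝ), IsProbabilityMeasure P ∧ IsProbabilityMeasure Q ∧
      P (Set.pi Set.univ (fun _ : ι => Set.Icc (-1 : ℝ) 1))ᶜ = 0 ∧ Q (Set.pi Set.univ (fun _ : ι => Set.Icc (-1 : ℝ) 1))ᶜ = 0 ∧
      ∃ r : ℝ, 0 < r ∧ r ≤ r₀ ∧ (∀ j : ι → ℕ, |∫ x, ∏ i, x i ^ j i ∂P - ∫ x, ∏ i, x i ^ j i ∂Q| ≤ r) ∧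
        ∃ h : ℝ → ℝ, (∀ τ τ' : ℝ, |h τ - h τ'| ≤ |τ - τ'|) ∧ (∀ τ, 0 ≤ h τ ∧ h τ ≤ Fintype.card ι) ∧
          (Fintype.card ι : ℝ) / 7 / (1 + Real.log r⁻¹) ≤ |∫ x, h (∑ i, x i) ∂P - ∫ x, h (∑ i, x i) ∂Q|) := by
  refine ⟨fun P Q _ _ hP hQ r hr0 hr1 hmom a A hA0 hA h hh K G hK0 hK hG =>
    law_price_ridge_le_of_uniformMixedMoments hP hQ hr0 hr1 hmom a hA0 hA hh hK0 hK hG, fun r₀ hr₀ hr₀1 => ?_⟩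
  -- choose `n ≥ 1` with `2(1∕2)^n ≤ r₀`
  obtain ⟨m, hm⟩ := exists_pow_lt_of_lt_one (half_pos hr₀) (by norm_num : (1 / 2 : ℝ) < 1)
  set n : ℕ := m + 1 with hn
  have hn0 : 0 < n := Nat.succ_pos m
  have hnr : (0 : ℝ) < n := by exact_mod_cast hn0
  have hr : 2 * (1 / 2 : ℝ) ^ n ≤ r₀ := by
    have : (1 / 2 : ℝ) ^ n ≤ (1 / 2 : ℝ) ^ m := pow_le_pow_of_le_one (by norm_num) (by norm_num) (Nat.le_succ m)
    linarith
  obtain ⟨P, Q, hPp, hQp, hP, hQ, hmom, hpay⟩ := exists_uniformMixedMoments_close_laws_ridge_far ι hn0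
  set d : ℕ := Fintype.card ι with hd
  have hd1 : (0 : ℝ) < d := by exact_mod_cast (Fintype.card_pos : 0 < d)
  refine ⟨P, Q, hPp, hQp, hP, hQ, 2 * (1 / 2 : ℝ) ^ n, by positivity, hr, hmom,
    fun τ => (d : ℝ) * ((1 - Real.cos (π * (2 * n : ℕ) * (τ / d))) / (π * (2 * n : ℕ))),
    abs_ridgeProfile_sub_le hd1 hn0, fun τ => ?_, ?_⟩
  · obtain ⟨h0, h1⟩ := ridgeProfile_mem hd1 hn0 τ
    refine ⟨h0, h1.trans ?_⟩
    rw [div_le_iff₀ (by positivity)]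
    have hπ : (3 : ℝ) < π := Real.pi_gt_three
    have hn1 : (1 : ℝ) ≤ n := by exact_mod_cast hn0
    have hπn : (1 : ℝ) ≤ π * n := by nlinarith
    nlinarith [mul_le_mul_of_nonneg_left hπn hd1.le]
  · have hint_eq : ∀ μ : Measure (ι → ℝ),
        ∫ x, (d : ℝ) * ((1 - Real.cos (π * (2 * n : ℕ) * ((∑ i, x i) / d))) / (π * (2 * n : ℕ))) ∂μ =
        ∫ x, (fun τ => (d : ℝ) * ((1 - Real.cos (π * (2 * n : ℕ) * (τ / d))) / (π * (2 * n : ℕ)))) (∑ i, x i) ∂μ :=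
      fun μ => rfl
    rw [← hint_eq P, ← hint_eq Q, hpay]
    -- `L = (n − 1) log 2`, and `d∕7∕(1 + L) ≤ d∕(πn)`
    have h2 : (2 * (1 / 2 : ℝ) ^ n)⁻¹ = 2 ^ m := by
      rw [hn, pow_succ, one_div, inv_pow]; field_simp
    have hL : Real.log (2 * (1 / 2 : ℝ) ^ n)⁻¹ = m * Real.log 2 := by rw [h2, Real.log_pow]
    rw [hL]
    have hlog2 : (0.6931471803 : ℝ) < Real.log 2 := Real.log_two_gt_d9
    have hπ : π < 3.15 := Real.pi_lt_d2
    have hm0 : (0 : ℝ) ≤ m := Nat.cast_nonneg m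
    have hnm : (n : ℝ) = m + 1 := by rw [hn]; push_cast; ring
    rw [div_div, div_le_div_iff₀ (by positivity) (by positivity), hnm]
    nlinarith [mul_nonneg hd1.le hm0, Real.pi_pos]

/-! ## §4 At the scheme: ridge statistics of `d` strings under the uniform target (module 67's push-forward BY NAME) [bookkeeping] -/

section AtScheme

open Filter Topology
open Literature.MathematicalPhysics.QuantumFieldTheory.Balaban1983to89
open T4GenFunBounds (prodObs gibbsMeasure schemeZ)
open Missing (TorusScheme)
open Summit.QuantumFields.BalabanUV.T4Continuum.Spine
open Summit.QuantumFields.YangMills.Theorems.BalabanUVNodesN19JointLawClosedFormAtScheme (jointLaw_pushforward)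

variable {G : Type*} [GaugeGroup G] [MeasurableSpace G] [RegularGaugeGroup G] [HaarData G] {O : Type*}
  (S : TorusScheme G O) (hβ : ∀ K, 0 ≤ S.β K) (hm : ∀ K o, Measurable (S.obs K o)) (h1 : ∀ K o U, |S.obs K o U| ≤ 1)
include hβ hm h1

/-- ★ **RIDGE STATISTICS OF `d` STRINGS AT THE SCHEME: `48(K_h A + G_h)∕(1 + log R_K⁻¹)`.**  Under `Spine.NE7.Target vol l₀ δ (schemeZ S os)` for
EVERY string (`0 < l₀`), for a finite family `os : ι → List O` with a continuum joint law `ν` on `[−1,1]^ι` receiving all continuous functionals,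
coefficients `a` with `Σ_i|a_i| ≤ A`, a continuous profile `h`, `K_h`-Lipschitz and `G_h`-bounded on `[−A, A]`, and every step `K` at which
`R_K = (4e^{1+l₀}∕l₀)·τ_K·(1 + log⁺τ_K⁻¹) ∈ (0, 1]`:
`|∫ h(Σ_i a_i ∏os_i) dgibbs_K − ∫ h(Σ_i a_i x_i) dν| ≤ 48(K_h A + G_h)∕(1 + log R_K⁻¹)` — LINEAR in `A ≤ d` (§2 at `r = R_K` on module 67's
push-forward), against module 67's `(76K d² + 12G d)∕(1 + log R_K⁻¹)` for general functionals.  CONDITIONAL on the uniform `Target` (N19's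
DECL-target shape for every string); nothing of Bałaban's instantiated. [bookkeeping] -/
theorem abs_integral_ridge_sub_jointLaw_le_of_uniformTarget {vol l₀ : ℝ} {δ : ℕ → ℝ}
    (hl₀ : 0 < l₀) (hT : ∀ os : List O, NE7.Target vol l₀ δ (schemeZ S os)) (os : ι → List O) (ν : Measure (ι → ℝ)) [IsProbabilityMeasure ν]
    (hν1 : ν (Set.pi Set.univ (fun _ : ι => Set.Icc (-1 : ℝ) 1))ᶜ = 0)
    (hν : ∀ f : (ι → ℝ) → ℝ, Continuous f →
      Tendsto (fun K => ∫ U, f (fun i => prodObs S K (os i) U) ∂gibbsMeasure (S.P K) (S.β K)) atTop (𝓝 (∫ x, f x ∂ν)))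
    (a : ι → ℝ) {A : ℝ} (hA0 : 0 < A) (hA : ∑ i, |a i| ≤ A) {h : ℝ → ℝ} (hh : Continuous h) {Kh Gh : ℝ} (hK0 : 0 ≤ Kh)
    (hK : ∀ s s' : ℝ, s ∈ Set.Icc (-A) A → s' ∈ Set.Icc (-A) A → |h s - h s'| ≤ Kh * |s - s'|)
    (hG : ∀ s : ℝ, s ∈ Set.Icc (-A) A → |h s| ≤ Gh) (K : ℕ)
    (hR0 : 0 < 4 * Real.exp (1 + l₀) / l₀ * (∑' j, 2 * (vol * δ (K + j))) * (1 + Real.posLog (∑' j, 2 * (vol * δ (K + j)))⁻¹))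
    (hR1 : 4 * Real.exp (1 + l₀) / l₀ * (∑' j, 2 * (vol * δ (K + j))) * (1 + Real.posLog (∑' j, 2 * (vol * δ (K + j)))⁻¹) ≤ 1) :
    |∫ U, h (∑ i, a i * prodObs S K (os i) U) ∂gibbsMeasure (S.P K) (S.β K) - ∫ x, h (∑ i, a i * x i) ∂ν| ≤
      48 * (Kh * A + Gh) /
        (1 + Real.log (4 * Real.exp (1 + l₀) / l₀ * (∑' j, 2 * (vol * δ (K + j))) * (1 + Real.posLog (∑' j, 2 * (vol * δ (K + j)))⁻¹))⁻¹) := by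
  obtain ⟨P, iP, hPc, hint, -, hmom⟩ := jointLaw_pushforward S hβ hm h1 hl₀ hT os ν hν K
  have hc : Continuous fun x : ι → ℝ => h (∑ i, a i * x i) :=
    hh.comp (continuous_finsetSum _ fun i _ => continuous_const.mul (continuous_apply i))
  rw [← hint hc]
  exact law_price_ridge_le_of_uniformMixedMoments hPc hν1 hR0 hR1 hmom a hA0 hA hh hK0 hK hG

end AtScheme

end Summit.QuantumFields.YangMills.Theorems.BalabanUVNodesN19JointLawPriceRidge

end
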